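import Literature.Computability.Cryptography.LWERegevMachineSample
import HarnessLib

/-!
# The oracle machine of Regev's decision-to-search reduction, III: the query generator `Q`

Topic `Computability/Cryptography` (LWE), grouping namespace `LWE.RegevBricks`, continuing
`LWERegevMachineSample.lean`. The query generator of the specification `RegevMachine c c'`
(`LWERegevMachineSpec.lean`) is assembled from clocked folds (`Brick.foldLoop` with clipped pieces,
`FoldBricks.lean`, `SelectBricks.lean`):

* over the coordinates `i' < n` of a slot (context `v = ⟨w, 1^{idx}⟩`): the framed residues of the
  tested vector `a'` (`aframesOutV`, an `appF`-fold of `aFrameP`) and the inner product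
  `⟨a', t⟩` as a natural (`ipSumV`, an `addFn`-fold of `ipP`); then `bin b''`,
  `b'' = b + [test] l k + ⟨a', t⟩ mod q` (`bOutV`), and the code of the transformed sample
  (`sampleOutV`, an `lweSampleCode` of `LWESampleCodes.lean`) — Regev's `f_t` of Lemma 4.1 composed with
  the coordinate test of Lemma 4.2;
* over the slots `idx < m` (context `w`): the block code (`qBlockW`, an `lweBlockCode`); finally
  **`queryQ c c'`** `= ⟨bin n, ⟨bin q, ⟨1ᵐ, block⟩⟩⟩` with `queryQ_mem_FP` and
  **`queryQ_wOf`**: on the root input of query `qi` it is `encodeLWESamples (queryBlock n S' r qi)`.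

## References

* O. Regev, *On lattices, learning with errors, random linear codes, and cryptography*, J. ACM 56
  (2009), art. 34, §4, Lemmas 4.1–4.2 (held: arXiv:2401.03703, p. 23). [cite: RegevLWE2009, §4 Lemma 4.1–4.2]
* S. Arora, B. Barak, *Computational Complexity: A Modern Approach*, CUP 2009, §1.3. [cite: AroraBarak2009, §1.3]
-/

noncomputable section

namespace Literature.Computability.Cryptography

namespace LWE

namespace RegevBricks

open _root_.Computability Polynomial Literature.Computability.Complexity Brick Plumb HashBricks RegevReduction

set_option synthInstance.maxSize 512

/-! ### Definitions -/

section Defs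

variable (c c' : ℕ)

/-- The loop record `⟨v, ⟨count, ⟨1⁰, ε⟩⟩⟩` with the count read off the root by `cnt`. [folklore] -/
def loopRec (cnt : List Bool → List Bool) : List Bool → List Bool :=
  fanoutFn (fun v => v) (fanoutFn cnt (fanoutFn (fun _ => []) (fun _ => [])))

/-- The one-item frame `boolPair (bin a'ᵢ') ε` (piece of the vector fold). [folklore] -/
def aFrameP : List Bool → List Bool := fanoutFn (aprimeU c c') (fun _ => [])

/-- The product `bin (a'ᵢ' · t_{j,i'})` (piece of the inner-product fold). [folklore] -/
def ipP : List Bool → List Bool := prodFn ∘ fanoutFn (aprimeU c c') (tvalU c c')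

/-- **The framed residues of the tested vector `a'`**: an `appF`-fold over `i' < n`. [cite: RegevLWE2009, §4 (proof of Lemma 4.2)] -/
def aframesOutV : List Bool → List Bool :=
  sndPow 2 ∘ foldLoop appF (clipF 4 (aFrameP c c')) X ∘ loopRec (bnW ∘ rootV)

/-- **`⟨a', t⟩` as a natural** (before reduction): an `addFn`-fold over `i' < n`. [cite: RegevLWE2009, §4 (proof of Lemma 4.1: f_t)] -/
def ipSumV : List Bool → List Bool :=
  sndPow 2 ∘ foldLoop addFn (clipF 2 (ipP c c')) X ∘ loopRec (bnW ∘ rootV)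

/-- **`bin b''`**, `b'' = (b + [test] l k + ⟨a', t⟩) mod q`. [cite: RegevLWE2009, §4 (proofs of Lemmas 4.1, 4.2)] -/
def bOutV : List Bool → List Bool :=
  remFn ∘ fanoutFn
    (addFn ∘ fanoutFn
      (addFn ∘ fanoutFn (bvalV c c')
        (iteFn (notFn (isGW c c' ∘ rootV)) (prodFn ∘ fanoutFn (lvalV c c') (bkW c c' ∘ rootV)) fun _ => []))
      (ipSumV c c'))
    (bqW ∘ rootV)

/-- The code `⟨⟨1ⁿ, frames of a'⟩, bin b''⟩` of the transformed sample of the slot. [cite: RegevLWE2009, §4 Lemma 4.1–4.2] -/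
def sampleOutV : List Bool → List Bool :=
  fanoutFn (fanoutFn (onesNW ∘ rootV) (aframesOutV c c')) (bOutV c c')

/-- The one-item frame of the transformed sample (piece of the block fold). [folklore] -/
def sampleFrameP : List Bool → List Bool := fanoutFn (sampleOutV c c') (fun _ => [])

/-- **The framed block**: an `appF`-fold over the slots `idx < m`. [cite: RegevLWE2009, §4 Lemma 4.1–4.2] -/
def qBlockW : List Bool → List Bool :=
  sndPow 2 ∘ foldLoop appF (clipF 64 (sampleFrameP c c')) X ∘ loopRec (bmW c c')

/-- **The query generator**: `⟨bin n, ⟨bin q, ⟨1ᵐ, block⟩⟩⟩`, the code of the queried block.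
[cite: RegevLWE2009, §4 Lemma 4.1–4.2] -/
def queryQ : List Bool → List Bool :=
  fanoutFn bnW (fanoutFn bqW (fanoutFn (onesMW c c') (qBlockW c c')))

end Defs

/-! ### Polynomial time -/

section FP

variable (c c' : ℕ)

/-- `loopRec cnt ∈ FP`. [folklore] -/
theorem loopRec_mem_FP {cnt : List Bool → List Bool} (h : cnt ∈ FP) : loopRec cnt ∈ FP :=
  fanoutFn_mem_FP OracleCompose.id_mem_FP (fanoutFn_mem_FP h (fanoutFn_mem_FP (const_mem_FP _) (const_mem_FP _)))
/-- `aFrameP ∈ FP`. [folklore] -/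
theorem aFrameP_mem_FP : aFrameP c c' ∈ FP := fanoutFn_mem_FP (aprimeU_mem_FP c c') (const_mem_FP _)
/-- `ipP ∈ FP`. [folklore] -/
theorem ipP_mem_FP : ipP c c' ∈ FP := comp_mem_FP prodFn_mem_FP (fanoutFn_mem_FP (aprimeU_mem_FP c c') (tvalU_mem_FP c c'))
/-- `aframesOutV ∈ FP`. [folklore] -/
theorem aframesOutV_mem_FP : aframesOutV c c' ∈ FP :=
  comp_mem_FP (sndPow_mem_FP 2) (comp_mem_FP (foldLoop_clipF_mem_FP 4 appF_mem_FP length_appF_le (aFrameP_mem_FP c c') X)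
    (loopRec_mem_FP (comp_mem_FP bnW_mem_FP rootV_mem_FP)))
/-- `ipSumV ∈ FP`. [folklore] -/
theorem ipSumV_mem_FP : ipSumV c c' ∈ FP :=
  comp_mem_FP (sndPow_mem_FP 2) (comp_mem_FP (foldLoop_clipF_mem_FP 2 addFn_mem_FP length_addFn_le (ipP_mem_FP c c') X)
    (loopRec_mem_FP (comp_mem_FP bnW_mem_FP rootV_mem_FP)))
/-- `bOutV ∈ FP`. [folklore] -/
theorem bOutV_mem_FP : bOutV c c' ∈ FP :=
  comp_mem_FP remFn_mem_FP (fanoutFn_mem_FP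
    (comp_mem_FP addFn_mem_FP (fanoutFn_mem_FP
      (comp_mem_FP addFn_mem_FP (fanoutFn_mem_FP (bvalV_mem_FP c c')
        (iteFn_mem_FP (notFn_mem_FP (comp_mem_FP (isGW_mem_FP c c') rootV_mem_FP))
          (comp_mem_FP prodFn_mem_FP (fanoutFn_mem_FP (lvalV_mem_FP c c') (comp_mem_FP (bkW_mem_FP c c') rootV_mem_FP)))
          (const_mem_FP _))))
      (ipSumV_mem_FP c c')))
    (comp_mem_FP bqW_mem_FP rootV_mem_FP))
/-- `sampleOutV ∈ FP`. [folklore] -/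
theorem sampleOutV_mem_FP : sampleOutV c c' ∈ FP :=
  fanoutFn_mem_FP (fanoutFn_mem_FP (comp_mem_FP onesNW_mem_FP rootV_mem_FP) (aframesOutV_mem_FP c c')) (bOutV_mem_FP c c')
/-- `sampleFrameP ∈ FP`. [folklore] -/
theorem sampleFrameP_mem_FP : sampleFrameP c c' ∈ FP := fanoutFn_mem_FP (sampleOutV_mem_FP c c') (const_mem_FP _)
/-- `qBlockW ∈ FP`. [folklore] -/
theorem qBlockW_mem_FP : qBlockW c c' ∈ FP :=
  comp_mem_FP (sndPow_mem_FP 2) (comp_mem_FP (foldLoop_clipF_mem_FP 64 appF_mem_FP length_appF_le (sampleFrameP_mem_FP c c') X)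
    (loopRec_mem_FP (bmW_mem_FP c c')))
/-- **`queryQ ∈ FP`.** [cite: AroraBarak2009, §1.3] -/
theorem queryQ_mem_FP : queryQ c c' ∈ FP :=
  fanoutFn_mem_FP bnW_mem_FP (fanoutFn_mem_FP bqW_mem_FP (fanoutFn_mem_FP (onesMW_mem_FP c c') (qBlockW_mem_FP c c')))

end FP

/-! ### Values -/

section Values

variable {c c' : ℕ} {n q m : ℕ} [NeZero q]
  {S' : Fin (Tpar c c' n * (n * q + 1) * Npar c c' n q * m) → (Fin n → ZMod q) × ZMod q} {r : List Bool}
  {qi : QIdx n q (Npar c c' n q) (Tpar c c' n)} {idx : Fin m}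

/-- A residue has a short numeral: `|bin v| ≤ q` for `v < q`. [folklore] -/
theorem length_encodeNat_le_of_lt {v q : ℕ} (h : v < q) : (encodeNat v).length ≤ q := by
  rw [TM2Pass.length_encodeNat_eq_size, Nat.size_le]
  exact h.trans Nat.lt_two_pow_self

/-- The contribution `[test] · l k` of the coordinate test to `b`. [cite: RegevLWE2009, §4 (proof of Lemma 4.2)] -/
def lkTerm (n : ℕ) (r : List Bool) (qi : QIdx n q (Npar c c' n q) (Tpar c c' n)) (idx : Fin m) : ZMod q :=
  match qi.2.1 with
  | none => 0
  | some ik => freshOf n r qi idx * ik.2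

/-- **The second entry of the transformed sample**: `b'' = b + [test] l k + ⟨a', t⟩`. [cite: RegevLWE2009, §4 Lemma 4.1–4.2] -/
def bOut (n : ℕ) (S' : Fin (Tpar c c' n * (n * q + 1) * Npar c c' n q * m) → (Fin n → ZMod q) × ZMod q)
    (r : List Bool) (qi : QIdx n q (Npar c c' n q) (Tpar c c' n)) (idx : Fin m) : ZMod q :=
  (inputOf S' qi idx).2 + lkTerm n r qi idx + aVec n S' r qi idx ⬝ᵥ shiftOf n r qi.1

/-- **The queried block, samplewise**: `(a', b'')`. [cite: RegevLWE2009, §4 (proofs of Lemmas 4.1, 4.2)] -/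
theorem queryBlock_eq (S' : Fin (Tpar c c' n * (n * q + 1) * Npar c c' n q * m) → (Fin n → ZMod q) × ZMod q)
    (r : List Bool) (qi : QIdx n q (Npar c c' n q) (Tpar c c' n)) (idx : Fin m) :
    queryBlock n S' r qi idx = (aVec n S' r qi idx, bOut n S' r qi idx) := by
  obtain ⟨j, e, rep⟩ := qi
  cases e with
  | none =>
    rw [queryBlock_none]
    simp [shiftSample, aVec, bOut, lkTerm, inputOf]
  | some ik =>
    obtain ⟨i, k⟩ := ik
    rw [queryBlock_some]
    simp [shiftSample, coordSample, aVec, bOut, lkTerm, inputOf]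

variable (S' r qi idx)

/-- Value of `loopRec`. [folklore] -/
theorem loopRec_apply (cnt : List Bool → List Bool) (v : List Bool) :
    loopRec cnt v = boolPair v (boolPair (cnt v) (boolPair (ones 0) [])) := by
  simp [loopRec]

/-- `uOf` over `vOf`. [folklore] -/
theorem uOf_eq' (i' : Fin n) : uOf S' r qi idx i' = boolPair (vOf S' r qi idx) (ones i') := rfl

/-- Value of `aFrameP` (raw index). [folklore] -/
theorem aFrameP_apply (hn : 0 < n) (hm : 0 < m) {i : ℕ} (hi : i < n) :
    aFrameP c c' (boolPair (vOf S' r qi idx) (ones i)) = boolPair (encodeNat (aVec n S' r qi idx ⟨i, hi⟩).val) [] := by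
  rw [aFrameP, fanoutFn_apply, ← uOf_eq' S' r qi idx ⟨i, hi⟩, aprimeU_apply hn hm]

/-- Value of `ipP` (raw index). [folklore] -/
theorem ipP_apply (hn : 0 < n) (hm : 0 < m) {i : ℕ} (hi : i < n) :
    ipP c c' (boolPair (vOf S' r qi idx) (ones i)) =
      encodeNat ((aVec n S' r qi idx ⟨i, hi⟩).val * ((shiftOf n r qi.1 : Fin n → ZMod q) ⟨i, hi⟩).val) := by
  rw [ipP, Function.comp_apply, fanoutFn_apply, ← uOf_eq' S' r qi idx ⟨i, hi⟩, aprimeU_apply hn hm, tvalU_apply hn hm,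
    prodFn_boolPair, bitsToNat_encodeNat, bitsToNat_encodeNat]

omit [NeZero q] in
/-- The framed body of a `Fin`-indexed family as a concatenation of one-item frames. [folklore] -/
theorem frames_ofFn_eq_ccat' {k : ℕ} (g : Fin k → List Bool) :
    frames (List.ofFn g) = ccat (fun i => boolPair (if h : i < k then g ⟨i, h⟩ else []) []) k := by
  rw [← frames_ofFn_eq_ccat_boolPair]
  congr 1
  exact List.ofFn_inj.2 (funext fun i => by rw [dif_pos i.isLt])

/-- **Value of `aframesOutV`**: the framed residues of `a'`. [cite: RegevLWE2009, §4 (proof of Lemma 4.2)] -/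
theorem aframesOutV_apply (hn : 0 < n) (hm : 0 < m) :
    aframesOutV c c' (vOf S' r qi idx) = frames (List.ofFn fun i' : Fin n => encodeNat (aVec n S' r qi idx i').val) := by
  obtain ⟨hnw, -, hqw, -⟩ := bounds_wOf S' r qi hn hm
  have hnv : n ≤ (X : Polynomial ℕ).eval (vOf S' r qi idx).length := by
    rw [eval_X, vOf_eq, length_boolPair]; omega
  rw [aframesOutV, Function.comp_apply, Function.comp_apply, loopRec_apply]
  simp only [Function.comp_apply, rootV, fstF_vOf, wOf_eq, bnW_apply]
  rw [foldLoop_apply _ _ hnv, sndPow_succ_boolPair, sndPow_succ_boolPair, sndPow_zero, sndF_boolPair, foldAcc_clipF,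
    foldAcc_appF, List.nil_append, frames_ofFn_eq_ccat']
  · refine ccat_congr fun i hi => ?_
    rw [zero_add, aFrameP_apply S' r qi idx hn hm hi, dif_pos hi]
  · intro i _ hi
    rw [zero_add] at hi
    rw [aFrameP_apply S' r qi idx hn hm hi, length_boolPair, List.length_nil, vOf_eq, length_boolPair]
    have := length_encodeNat_le_of_lt (ZMod.val_lt (aVec n S' r qi idx ⟨i, hi⟩))
    omega

/-- **Value of `ipSumV`**: `bin (∑ᵢ a'ᵢ.val · tᵢ.val)`. [cite: RegevLWE2009, §4 (proof of Lemma 4.1)] -/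
theorem ipSumV_apply (hn : 0 < n) (hm : 0 < m) :
    ipSumV c c' (vOf S' r qi idx) =
      encodeNat (∑ i' : Fin n, (aVec n S' r qi idx i').val * ((shiftOf n r qi.1 : Fin n → ZMod q) i').val) := by
  obtain ⟨hnw, -, hqw, -⟩ := bounds_wOf S' r qi hn hm
  have hnv : n ≤ (X : Polynomial ℕ).eval (vOf S' r qi idx).length := by
    rw [eval_X, vOf_eq, length_boolPair]; omega
  rw [ipSumV, Function.comp_apply, Function.comp_apply, loopRec_apply]
  simp only [Function.comp_apply, rootV, fstF_vOf, wOf_eq, bnW_apply]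
  rw [foldLoop_apply _ _ hnv, sndPow_succ_boolPair, sndPow_succ_boolPair, sndPow_zero, sndF_boolPair, foldAcc_clipF]
  · refine (foldAcc_addFn _ _ n 0 0).trans (congrArg encodeNat ?_)
    rw [zero_add, Finset.sum_range]
    refine Finset.sum_congr rfl fun i' _ => ?_
    rw [zero_add, ipP_apply S' r qi idx hn hm i'.isLt, bitsToNat_encodeNat]
  · intro i _ hi
    rw [zero_add] at hi
    rw [ipP_apply S' r qi idx hn hm hi, vOf_eq, length_boolPair]
    have h1 := length_encodeNat_le_of_lt (ZMod.val_lt (aVec n S' r qi idx ⟨i, hi⟩))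
    have h2 := length_encodeNat_le_of_lt (ZMod.val_lt ((shiftOf n r qi.1 : Fin n → ZMod q) ⟨i, hi⟩))
    have h3 := length_encodeNat_mul_le (encodeNat (aVec n S' r qi idx ⟨i, hi⟩).val)
      (encodeNat ((shiftOf n r qi.1 : Fin n → ZMod q) ⟨i, hi⟩).val)
    rw [bitsToNat_encodeNat, bitsToNat_encodeNat] at h3
    omega

/-- The `[test] · l.val k.val` natural the machine adds (unreduced). [folklore] -/
def lkNat (n : ℕ) (r : List Bool) (qi : QIdx n q (Npar c c' n q) (Tpar c c' n)) (idx : Fin m) : ℕ :=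
  match qi.2.1 with
  | none => 0
  | some ik => (freshOf n r qi idx).val * ik.2.val

/-- `lkNat` reduces to `lkTerm`. [folklore] -/
theorem cast_lkNat : ((lkNat n r qi idx : ℕ) : ZMod q) = lkTerm n r qi idx := by
  obtain ⟨j, e, rep⟩ := qi
  cases e with
  | none => simp [lkNat, lkTerm]
  | some ik => obtain ⟨i, k⟩ := ik; simp [lkNat, lkTerm]

/-- The `[test] · l k` numeral of the machine. [folklore] -/
theorem lkIte_apply (hn : 0 < n) (hm : 0 < m) (j : Fin (Tpar c c' n)) (e : Est n q) (rep : Fin (Npar c c' n q)) :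
    iteFn (notFn (isGW c c' ∘ rootV)) (prodFn ∘ fanoutFn (lvalV c c') (bkW c c' ∘ rootV)) (fun _ => [])
      (vOf S' r (j, e, rep) idx) = encodeNat (lkNat n r (j, e, rep) idx) := by
  have hN : 0 < Npar c c' n q := Npar_pos hn (Nat.pos_of_ne_zero (NeZero.ne q))
  have h1 : notFn (isGW c c' ∘ rootV) (vOf S' r (j, e, rep) idx) = [!decide (e = none)] :=
    notFn_apply (by simp only [rootV, Function.comp_apply, fstF_vOf]; rw [wOf_eq]; exact isGW_apply S' r j e rep hN)
  rw [iteFn_apply h1]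
  cases e with
  | none => rfl
  | some ik =>
    obtain ⟨i, k⟩ := ik
    have h2 : (prodFn ∘ fanoutFn (lvalV c c') (bkW c c' ∘ rootV)) (vOf S' r (j, some (i, k), rep) idx) =
        encodeNat ((freshOf n r (j, some (i, k), rep) idx).val * k.val) := by
      simp only [Function.comp_apply, fanoutFn_apply, rootV, fstF_vOf, lvalV_apply hn hm]
      rw [wOf_eq, bkW_apply S' r j rep i k hN, prodFn_boolPair, bitsToNat_encodeNat, bitsToNat_encodeNat]
    rw [show (!decide (some (i, k) = (none : Est n q))) = true by simp, if_pos rfl, h2]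
    rfl

/-- **Value of `bOutV`**: `bin b''`. [cite: RegevLWE2009, §4 Lemma 4.1–4.2] -/
theorem bOutV_apply (hn : 0 < n) (hm : 0 < m) : bOutV c c' (vOf S' r qi idx) = encodeNat (bOut n S' r qi idx).val := by
  obtain ⟨j, e, rep⟩ := qi
  have hlk := lkIte_apply S' r idx hn hm j e rep
  rw [bOutV, Function.comp_apply, fanoutFn_apply, Function.comp_apply, fanoutFn_apply, Function.comp_apply, fanoutFn_apply,
    bvalV_apply hn hm, ipSumV_apply S' r _ idx hn hm, hlk]
  simp only [addFn_boolPair, bitsToNat_encodeNat, remFn_boolPair, Function.comp_apply, rootV, fstF_vOf, wOf_eq, bqW_apply]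
  rw [← ZMod.val_natCast]
  refine congrArg encodeNat (congrArg ZMod.val ?_)
  simp only [Nat.cast_add, Nat.cast_sum, Nat.cast_mul, ZMod.natCast_zmod_val, cast_lkNat, bOut, dotProduct]

/-- `nq + 1 ≤ |w|`. [folklore] -/
theorem nq_succ_le_length_wOf (hn : 0 < n) (hm : 0 < m) : n * q + 1 ≤ (wOf S' r qi).length := by
  obtain ⟨-, -, -, -, -, hM, -⟩ := bounds_wOf S' r qi hn hm
  refine le_trans ?_ hM
  have hT : 1 ≤ Tpar c c' n := Tpar_pos hn
  have hN : 1 ≤ Npar c c' n q := Npar_pos hn (Nat.pos_of_ne_zero (NeZero.ne q))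
  calc n * q + 1 = 1 * (n * q + 1) * 1 * 1 := by ring
    _ ≤ Tpar c c' n * (n * q + 1) * Npar c c' n q * m :=
      Nat.mul_le_mul (Nat.mul_le_mul (Nat.mul_le_mul_right _ hT) hN) hm

/-- **Value of `sampleOutV`**: the code `lweSampleCode` of the transformed sample of the slot.
[cite: RegevLWE2009, §4 Lemma 4.1–4.2] -/
theorem sampleOutV_apply (hn : 0 < n) (hm : 0 < m) :
    sampleOutV c c' (vOf S' r qi idx) = lweSampleCode (queryBlock n S' r qi idx) := by
  obtain ⟨hnw, -⟩ := bounds_wOf S' r qi hn hm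
  rw [sampleOutV, fanoutFn_apply, fanoutFn_apply, aframesOutV_apply S' r qi idx hn hm, bOutV_apply S' r qi idx hn hm,
    queryBlock_eq, lweSampleCode, lweResidueCode, frames_eq_encList]
  simp only [Function.comp_apply, rootV, fstF_vOf]
  rw [wOf_eq, onesNW_apply S' r _ (by rw [← wOf_eq]; exact hnw)]

/-- `vOf` over `wOf`. [folklore] -/
theorem vOf_eq' (idx : Fin m) : vOf S' r qi idx = boolPair (wOf S' r qi) (ones idx) := rfl

/-- Value of `sampleFrameP` (raw slot index). [folklore] -/
theorem sampleFrameP_apply (hn : 0 < n) (hm : 0 < m) {i : ℕ} (hi : i < m) :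
    sampleFrameP c c' (boolPair (wOf S' r qi) (ones i)) = boolPair (lweSampleCode (queryBlock n S' r qi ⟨i, hi⟩)) [] := by
  rw [sampleFrameP, fanoutFn_apply, ← vOf_eq' S' r qi ⟨i, hi⟩, sampleOutV_apply S' r qi _ hn hm]

/-- **Value of `qBlockW`**: the block code of query `qi`. [cite: RegevLWE2009, §4 Lemma 4.1–4.2] -/
theorem qBlockW_apply (hn : 0 < n) (hm : 0 < m) :
    qBlockW c c' (wOf S' r qi) = lweBlockCode (queryBlock n S' r qi) := by
  have hq : 0 < q := Nat.pos_of_ne_zero (NeZero.ne q)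
  obtain ⟨hnw, hmw, hqw, -⟩ := bounds_wOf S' r qi hn hm
  have hnq := nq_succ_le_length_wOf S' r qi hn hm
  have hbq : (encodeNat q).length ≤ q + 1 := length_encodeNat_le_of_lt (Nat.lt_succ_self q)
  have hmX : m ≤ (X : Polynomial ℕ).eval (wOf S' r qi).length := by rwa [eval_X]
  rw [qBlockW, Function.comp_apply, Function.comp_apply, loopRec_apply, wOf_eq, bmW_apply S' r _ hn hq, ← wOf_eq,
    foldLoop_apply _ _ hmX, sndPow_succ_boolPair, sndPow_succ_boolPair, sndPow_zero, sndF_boolPair, foldAcc_clipF,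
    foldAcc_appF, List.nil_append, lweBlockCode, ← frames_eq_encList, frames_ofFn_eq_ccat']
  · refine ccat_congr fun i hi => ?_
    rw [zero_add, sampleFrameP_apply S' r qi hn hm hi, dif_pos hi]
  · intro i _ hi
    rw [zero_add] at hi
    rw [sampleFrameP_apply S' r qi hn hm hi, length_boolPair, List.length_nil]
    have h1 := length_lweSampleCode_le (queryBlock n S' r qi ⟨i, hi⟩)
    rw [sampleCodeBound] at h1
    have h2 : n * q ≤ (wOf S' r qi).length := by omega
    have h3 : (4 * n + 1) * (encodeNat q).length ≤ 5 * (n * (q + 1)) := by nlinarith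
    nlinarith

/-- **The query generator meets its specification**: on the root input of query `qi` it returns
the code of the queried block. [cite: RegevLWE2009, §4 Lemma 4.1–4.2] -/
theorem queryQ_wOf (hn : 0 < n) (hm : 0 < m) :
    queryQ c c' (wOf S' r qi) = encodeLWESamples (queryBlock n S' r qi) := by
  have hq : 0 < q := Nat.pos_of_ne_zero (NeZero.ne q)
  obtain ⟨hnw, hmw, -⟩ := bounds_wOf S' r qi hn hm
  rw [queryQ, fanoutFn_apply, fanoutFn_apply, fanoutFn_apply, qBlockW_apply S' r qi hn hm, encodeLWESamples_eq, wOf_eq,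
    bnW_apply, bqW_apply, onesMW_apply S' r _ hn hq (by rw [← wOf_eq]; exact hmw)]

end Values

end RegevBricks

end LWE

end Literature.Computability.Cryptography

end
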